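import Summits.CriticalPhenomena.CardyFormulaZ2.Theses.CardyRotToConf
import Literature.Topology.PlaneTopology.CrosscutProofs
import Summits.CriticalPhenomena.CardyFormulaZ2.Theorems.CardyRotToConfR2SymmetryUpgrade.Negative.SurgCrosscutSplit
import HarnessLib

/-!
# The crosscut domain `(D_b; q, b)` as a Dobrushin domain
# (one-shot surgery for crux `CardyRotToConfR2SymmetryUpgrade`, stmt-CriticalPhenomena-0698)

`bComponent`, `otherComponent`, `bArc`, `otherArc`, `bJordanDomain`, `crosscutDomain` and the typed
remaining domain after a crosscut past (`remainingDomain_eq_crosscutDomain`).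
Negative lane: no Theses statement is asserted; overview in `Negative/OneShotSurgery.lean`.
-/

noncomputable section

open Set Filter Topology Bornology
open Literature.Probability.RandomPlanarGeometry
open Literature.Topology.PlaneTopology

namespace Summit.CriticalPhenomena.CardyFormulaZ2.Theorems.CardyRotToConfR2SymmetryUpgrade.Negative

variable (D : DobrushinDomain)

section Domain

variable {D}
variable {L : Set ℂ} {q : ℂ} (hL : D.IsCrosscut L (D.pt 0) q) (hqb : q ≠ D.pt 1)
include hL hqb

/-- The data of `exists_crosscut_split`, chosen once. -/
private theorem split_spec :
    ∃ U V A A' : Set ℂ, IsOpen U ∧ IsOpen V ∧ IsConnected U ∧ IsConnected V ∧ Disjoint U V ∧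
      U ∪ V = D.carrier \ L ∧ frontier U = L ∪ A ∧ frontier V = L ∪ A' ∧
      A ∪ A' = frontier D.carrier ∧ A ∩ A' ⊆ {D.pt 0, q} ∧ D.pt 1 ∈ A ∧ D.pt 1 ∉ A' ∧
      IsSimpleArc A (D.pt 0) q ∧ IsSimpleArc A' q (D.pt 0) ∧ A ⊆ frontier D.carrier ∧
      A' ⊆ frontier D.carrier :=
  exists_crosscut_split hL hqb

/-- The `b`-adjacent component `U` of `D ∖ L`. [folklore] -/
def bComponent : Set ℂ := (split_spec hL hqb).choose

/-- The other component `V` of `D ∖ L`. [folklore] -/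
def otherComponent : Set ℂ := (split_spec hL hqb).choose_spec.choose

/-- The boundary arc of `∂D` through `b` cut off by `a`, `q`. [folklore] -/
def bArc : Set ℂ := (split_spec hL hqb).choose_spec.choose_spec.choose

/-- The other boundary arc. [folklore] -/
def otherArc : Set ℂ := (split_spec hL hqb).choose_spec.choose_spec.choose_spec.choose

/-- All properties of the four chosen sets. -/
theorem split_props :
    IsOpen (bComponent hL hqb) ∧ IsOpen (otherComponent hL hqb) ∧
      IsConnected (bComponent hL hqb) ∧ IsConnected (otherComponent hL hqb) ∧
      Disjoint (bComponent hL hqb) (otherComponent hL hqb) ∧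
      bComponent hL hqb ∪ otherComponent hL hqb = D.carrier \ L ∧
      frontier (bComponent hL hqb) = L ∪ bArc hL hqb ∧
      frontier (otherComponent hL hqb) = L ∪ otherArc hL hqb ∧
      bArc hL hqb ∪ otherArc hL hqb = frontier D.carrier ∧
      bArc hL hqb ∩ otherArc hL hqb ⊆ {D.pt 0, q} ∧ D.pt 1 ∈ bArc hL hqb ∧
      D.pt 1 ∉ otherArc hL hqb ∧ IsSimpleArc (bArc hL hqb) (D.pt 0) q ∧
      IsSimpleArc (otherArc hL hqb) q (D.pt 0) ∧ bArc hL hqb ⊆ frontier D.carrier ∧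
      otherArc hL hqb ⊆ frontier D.carrier :=
  (split_spec hL hqb).choose_spec.choose_spec.choose_spec.choose_spec

/-- `isOpen_bComponent`: isOpen bComponent (auxiliary lemma of the one-shot surgery; the statement is the specification). -/
theorem isOpen_bComponent : IsOpen (bComponent hL hqb) := (split_props hL hqb).1
/-- `isConnected_bComponent`: isConnected bComponent (auxiliary lemma of the one-shot surgery; the statement is the specification). -/
theorem isConnected_bComponent : IsConnected (bComponent hL hqb) := (split_props hL hqb).2.2.1
/-- `isOpen_otherComponent`: isOpen otherComponent (auxiliary lemma of the one-shot surgery; the statement is the specification). -/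
theorem isOpen_otherComponent : IsOpen (otherComponent hL hqb) := (split_props hL hqb).2.1
/-- `isConnected_otherComponent`: isConnected otherComponent (auxiliary lemma of the one-shot surgery; the statement is the specification). -/
theorem isConnected_otherComponent : IsConnected (otherComponent hL hqb) :=
  (split_props hL hqb).2.2.2.1
/-- `disjoint_components`: disjoint components (auxiliary lemma of the one-shot surgery; the statement is the specification). -/
theorem disjoint_components : Disjoint (bComponent hL hqb) (otherComponent hL hqb) :=
  (split_props hL hqb).2.2.2.2.1
/-- `union_components`: union components (auxiliary lemma of the one-shot surgery; the statement is the specification). -/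
theorem union_components : bComponent hL hqb ∪ otherComponent hL hqb = D.carrier \ L :=
  (split_props hL hqb).2.2.2.2.2.1
/-- `frontier_bComponent`: frontier bComponent (auxiliary lemma of the one-shot surgery; the statement is the specification). -/
theorem frontier_bComponent : frontier (bComponent hL hqb) = L ∪ bArc hL hqb :=
  (split_props hL hqb).2.2.2.2.2.2.1
/-- `frontier_otherComponent`: frontier otherComponent (auxiliary lemma of the one-shot surgery; the statement is the specification). -/
theorem frontier_otherComponent : frontier (otherComponent hL hqb) = L ∪ otherArc hL hqb :=
  (split_props hL hqb).2.2.2.2.2.2.2.1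
/-- `bArc_union_otherArc`: bArc union otherArc (auxiliary lemma of the one-shot surgery; the statement is the specification). -/
theorem bArc_union_otherArc : bArc hL hqb ∪ otherArc hL hqb = frontier D.carrier :=
  (split_props hL hqb).2.2.2.2.2.2.2.2.1
/-- `bArc_inter_otherArc`: bArc inter otherArc (auxiliary lemma of the one-shot surgery; the statement is the specification). -/
theorem bArc_inter_otherArc : bArc hL hqb ∩ otherArc hL hqb ⊆ {D.pt 0, q} :=
  (split_props hL hqb).2.2.2.2.2.2.2.2.2.1
/-- `pt_one_mem_bArc`: pt one mem bArc (auxiliary lemma of the one-shot surgery; the statement is the specification). -/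
theorem pt_one_mem_bArc : D.pt 1 ∈ bArc hL hqb := (split_props hL hqb).2.2.2.2.2.2.2.2.2.2.1
/-- `pt_one_notMem_otherArc`: pt one notMem otherArc (auxiliary lemma of the one-shot surgery; the statement is the specification). -/
theorem pt_one_notMem_otherArc : D.pt 1 ∉ otherArc hL hqb :=
  (split_props hL hqb).2.2.2.2.2.2.2.2.2.2.2.1
/-- `isSimpleArc_bArc`: isSimpleArc bArc (auxiliary lemma of the one-shot surgery; the statement is the specification). -/
theorem isSimpleArc_bArc : IsSimpleArc (bArc hL hqb) (D.pt 0) q :=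
  (split_props hL hqb).2.2.2.2.2.2.2.2.2.2.2.2.1
/-- `isSimpleArc_otherArc`: isSimpleArc otherArc (auxiliary lemma of the one-shot surgery; the statement is the specification). -/
theorem isSimpleArc_otherArc : IsSimpleArc (otherArc hL hqb) q (D.pt 0) :=
  (split_props hL hqb).2.2.2.2.2.2.2.2.2.2.2.2.2.1
/-- `bArc_subset_frontier`: bArc subset frontier (auxiliary lemma of the one-shot surgery; the statement is the specification). -/
theorem bArc_subset_frontier : bArc hL hqb ⊆ frontier D.carrier :=
  (split_props hL hqb).2.2.2.2.2.2.2.2.2.2.2.2.2.2.1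
/-- `otherArc_subset_frontier`: otherArc subset frontier (auxiliary lemma of the one-shot surgery; the statement is the specification). -/
theorem otherArc_subset_frontier : otherArc hL hqb ⊆ frontier D.carrier :=
  (split_props hL hqb).2.2.2.2.2.2.2.2.2.2.2.2.2.2.2

/-- `bComponent_subset`: bComponent subset (auxiliary lemma of the one-shot surgery; the statement is the specification). -/
theorem bComponent_subset : bComponent hL hqb ⊆ D.carrier \ L :=
  union_components hL hqb ▸ subset_union_left

/-- `otherComponent_subset`: otherComponent subset (auxiliary lemma of the one-shot surgery; the statement is the specification). -/
theorem otherComponent_subset : otherComponent hL hqb ⊆ D.carrier \ L :=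
  union_components hL hqb ▸ subset_union_right

/-- `b` is not on the crosscut. [folklore] -/
theorem pt_one_notMem_crosscut : D.pt 1 ∉ L := by
  intro hb
  have hsub := hL.2.2.2.2
  by_cases h : D.pt 1 ∈ ({D.pt 0, q} : Set ℂ)
  · rcases h with h | h
    · exact absurd (D.pt_injective h) (by decide)
    · exact hqb h.symm
  · have hD : D.pt 1 ∈ D.carrier := hsub ⟨hb, h⟩
    have hfr := D.pt_mem_frontier 1
    rw [D.isOpen.frontier_eq] at hfr
    exact hfr.2 hD

/-- `b` lies on the frontier of the `b`-component and not in the closure of the other one.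
[folklore] -/
theorem pt_one_mem_frontier_bComponent : D.pt 1 ∈ frontier (bComponent hL hqb) := by
  rw [frontier_bComponent]
  exact Or.inr (pt_one_mem_bArc hL hqb)

/-- `pt_one_notMem_closure_otherComponent`: pt one notMem closure otherComponent (auxiliary lemma of the one-shot surgery; the statement is the specification). -/
theorem pt_one_notMem_closure_otherComponent : D.pt 1 ∉ closure (otherComponent hL hqb) := by
  rw [closure_eq_self_union_frontier, frontier_otherComponent]
  rintro (h | h | h)
  · exact (D.pt_mem_frontier 1 |> fun hfr => by
      rw [D.isOpen.frontier_eq] at hfr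
      exact hfr.2 (otherComponent_subset hL hqb h).1)
  · exact pt_one_notMem_crosscut hL hqb h
  · exact pt_one_notMem_otherArc hL hqb h

/-- The boundary loop of the `b`-component: the `b`-arc followed by the crosscut reversed is a
Jordan curve. [folklore] -/
theorem exists_loop_bComponent :
    ∃ γ : ℝ → ℂ, Continuous γ ∧ Function.Periodic γ 1 ∧ InjOn γ (Ico 0 1) ∧
      range γ = L ∪ bArc hL hqb := by
  -- `bArc` from `a` to `q`, then `L` reversed from `q` to `a`
  have h₁ := isSimpleArc_bArc hL hqb
  have h₂ : IsSimpleArc L q (D.pt 0) := hL.1.symm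
  have hmeet : bArc hL hqb ∩ L ⊆ {D.pt 0, q} := by
    rintro z ⟨hzA, hzL⟩
    by_contra hz
    have hzD : z ∈ D.carrier := hL.2.2.2.2 ⟨hzL, hz⟩
    have hzfr : z ∈ frontier D.carrier := bArc_subset_frontier hL hqb hzA
    rw [D.isOpen.frontier_eq] at hzfr
    exact hzfr.2 hzD
  obtain ⟨γ, hγ, hp, hinj, hrange⟩ := h₁.exists_periodic_of_union h₂ hmeet
  exact ⟨γ, hγ, hp, hinj, by rw [hrange, union_comm]⟩

/-- The `b`-component as a Jordan domain (boundary loop from `exists_loop_bComponent`).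
[folklore] -/
def bJordanDomain : JordanDomain where
  carrier := bComponent hL hqb
  boundary := (exists_loop_bComponent hL hqb).choose
  isOpen := isOpen_bComponent hL hqb
  isBounded := D.isBounded.subset fun z hz => (bComponent_subset hL hqb hz).1
  isConnected := isConnected_bComponent hL hqb
  continuous_boundary := (exists_loop_bComponent hL hqb).choose_spec.1
  periodic_boundary := (exists_loop_bComponent hL hqb).choose_spec.2.1
  injOn_boundary := (exists_loop_bComponent hL hqb).choose_spec.2.2.1
  range_boundary := by
    rw [(exists_loop_bComponent hL hqb).choose_spec.2.2.2, frontier_bComponent]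

/-- `carrier_bJordanDomain`: carrier bJordanDomain (auxiliary lemma of the one-shot surgery; the statement is the specification). -/
@[simp] theorem carrier_bJordanDomain : (bJordanDomain hL hqb).carrier = bComponent hL hqb := rfl

/-- `range_boundary_bJordanDomain`: range boundary bJordanDomain (auxiliary lemma of the one-shot surgery; the statement is the specification). -/
theorem range_boundary_bJordanDomain :
    range (bJordanDomain hL hqb).boundary = L ∪ bArc hL hqb :=
  (exists_loop_bComponent hL hqb).choose_spec.2.2.2

/-- `q` and `b` are on the boundary loop of the `b`-component, at distinct parameters of the
fundamental period. [folklore] -/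
theorem exists_params_q_b :
    ∃ u v : ℝ, u ∈ Ico (0 : ℝ) 1 ∧ v ∈ Ico (0 : ℝ) 1 ∧ u ≠ v ∧
      (bJordanDomain hL hqb).boundary u = q ∧ (bJordanDomain hL hqb).boundary v = D.pt 1 := by
  set E := bJordanDomain hL hqb
  have hq : q ∈ range E.boundary := by
    rw [range_boundary_bJordanDomain]
    exact Or.inl hL.1.right_mem
  have hb : D.pt 1 ∈ range E.boundary := by
    rw [range_boundary_bJordanDomain]
    exact Or.inr (pt_one_mem_bArc hL hqb)
  rw [E.range_boundary, E.frontier_eq_image_Ico] at hq hb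
  obtain ⟨u, hu, huq⟩ := hq
  obtain ⟨v, hv, hvb⟩ := hb
  refine ⟨u, v, hu, hv, ?_, huq, hvb⟩
  rintro rfl
  exact hqb (huq.symm.trans hvb)

/-- **The crosscut component as a Dobrushin domain** `(U; q, b)`: carrier = the component of
`D ∖ L` adjacent to `b`, first mark at `q` (parameter shifted to `0`), second mark at `b`.
[folklore] -/
def crosscutDomain : DobrushinDomain :=
  let E := bJordanDomain hL hqb
  let u := (exists_params_q_b hL hqb).choose
  let v := (exists_params_q_b hL hqb).choose_spec.choose
  { carrier := E.carrier
    boundary := fun s => E.boundary (s + u)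
    isOpen := E.isOpen
    isBounded := E.isBounded
    isConnected := E.isConnected
    continuous_boundary := E.continuous_boundary.comp (continuous_id.add continuous_const)
    periodic_boundary := fun s => by
      show E.boundary (s + 1 + u) = E.boundary (s + u)
      rw [add_right_comm, E.periodic_boundary]
    injOn_boundary := by
      intro s hs s' hs' h
      have h' : E.boundary (s + u) = E.boundary (s' + u) := h
      have := E.injOn_boundary_Ico u ⟨by linarith [hs.1], by linarith [hs.2]⟩
        ⟨by linarith [hs'.1], by linarith [hs'.2]⟩ h'
      linarith
    range_boundary := by
      rw [← E.range_boundary]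
      ext z
      constructor
      · rintro ⟨s, rfl⟩
        exact ⟨s + u, rfl⟩
      · rintro ⟨s, rfl⟩
        exact ⟨s - u, by simp⟩
    mark := ![0, Int.fract (v - u)]
    strictMono_mark := by
      refine Fin.strictMono_iff_lt_succ.2 fun k => ?_
      fin_cases k
      simp only [Fin.reduceCastSucc, Fin.zero_eta, Matrix.cons_val_zero, Fin.reduceSucc,
        Matrix.cons_val_one, Matrix.cons_val_fin_one]
      refine lt_of_le_of_ne (Int.fract_nonneg _) fun h => ?_
      -- `fract (v - u) = 0` would force `boundary v = boundary u`
      have hspec := (exists_params_q_b hL hqb).choose_spec.choose_spec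
      obtain ⟨hu, hv, huv, huq, hvb⟩ := hspec
      have hint : ∃ n : ℤ, v - u = n := by
        rw [eq_comm, Int.fract_eq_iff] at h
        obtain ⟨-, -, n, hn⟩ := h
        exact ⟨n, by linarith⟩
      obtain ⟨n, hn⟩ := hint
      have hn0 : n = 0 := by
        have h1 : (-1 : ℝ) < v - u := by linarith [hu.2, hv.1]
        have h2 : v - u < 1 := by linarith [hu.1, hv.2]
        rw [hn] at h1 h2
        have : (-1 : ℤ) < n := by exact_mod_cast h1
        have : n < 1 := by exact_mod_cast h2
        omega
      rw [hn0, Int.cast_zero, sub_eq_zero] at hn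
      exact huv hn.symm
    mark_mem := fun k => by
      fin_cases k
      · simp
      · exact ⟨Int.fract_nonneg _, Int.fract_lt_one _⟩ }

/-- `carrier_crosscutDomain`: carrier crosscutDomain (auxiliary lemma of the one-shot surgery; the statement is the specification). -/
@[simp] theorem carrier_crosscutDomain : (crosscutDomain hL hqb).carrier = bComponent hL hqb := rfl

/-- The first marked point of the crosscut domain is the landing point `q`. [folklore] -/
theorem pt_zero_crosscutDomain : (crosscutDomain hL hqb).pt 0 = q := by
  have hspec := (exists_params_q_b hL hqb).choose_spec.choose_spec
  have h0 : (crosscutDomain hL hqb).mark 0 = 0 := rfl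
  show (bJordanDomain hL hqb).boundary
      ((crosscutDomain hL hqb).mark 0 + (exists_params_q_b hL hqb).choose) = q
  rw [h0, zero_add]
  exact hspec.2.2.2.1

/-- The second marked point of the crosscut domain is the target `b`. [folklore] -/
theorem pt_one_crosscutDomain : (crosscutDomain hL hqb).pt 1 = D.pt 1 := by
  have hspec := (exists_params_q_b hL hqb).choose_spec.choose_spec
  have h1 : (crosscutDomain hL hqb).mark 1 =
      Int.fract ((exists_params_q_b hL hqb).choose_spec.choose - (exists_params_q_b hL hqb).choose) :=
    rfl
  show (bJordanDomain hL hqb).boundary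
      ((crosscutDomain hL hqb).mark 1 + (exists_params_q_b hL hqb).choose) = D.pt 1
  rw [h1]
  set u := (exists_params_q_b hL hqb).choose
  set v := (exists_params_q_b hL hqb).choose_spec.choose
  have : Int.fract (v - u) + u = v - (⌊v - u⌋ : ℤ) * (1 : ℝ) := by
    rw [Int.fract]
    ring
  rw [this, (bJordanDomain hL hqb).periodic_boundary.sub_int_mul_eq]
  exact hspec.2.2.2.2

/-- The frontier of the crosscut domain is `L ∪ (arc of ∂D through b)`. [folklore] -/
theorem frontier_crosscutDomain :
    frontier (crosscutDomain hL hqb).carrier = L ∪ bArc hL hqb :=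
  frontier_bComponent hL hqb

/-- The crosscut domain lies in `D ∖ L`. [folklore] -/
theorem carrier_crosscutDomain_subset : (crosscutDomain hL hqb).carrier ⊆ D.carrier \ L :=
  bComponent_subset hL hqb

/-- The closure of the crosscut domain lies in the closure of `D`. [folklore] -/
theorem closure_crosscutDomain_subset :
    closure (crosscutDomain hL hqb).carrier ⊆ closure D.carrier := by
  rw [closure_eq_self_union_frontier, frontier_crosscutDomain, carrier_crosscutDomain]
  rintro z (hz | hz | hz)
  · exact subset_closure (bComponent_subset hL hqb hz).1
  · rcases em (z ∈ ({D.pt 0, q} : Set ℂ)) with h | h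
    · rcases h with rfl | rfl
      · exact frontier_subset_closure (D.pt_mem_frontier 0)
      · exact frontier_subset_closure hL.2.2.1
    · exact subset_closure (hL.2.2.2.2 ⟨hz, h⟩)
  · exact frontier_subset_closure (bArc_subset_frontier hL hqb hz)

/-- Connected components of `D ∖ L`: a point of the `b`-component has the `b`-component as its
component, a point of the other component the other one. [folklore] -/
theorem connectedComponentIn_eq_bComponent {z : ℂ} (hz : z ∈ bComponent hL hqb) :
    connectedComponentIn (D.carrier \ L) z = bComponent hL hqb := by
  apply Subset.antisymm
  · have hsub : connectedComponentIn (D.carrier \ L) z ⊆ bComponent hL hqb ∪ otherComponent hL hqb :=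
      union_components hL hqb ▸ connectedComponentIn_subset _ _
    rcases isPreconnected_connectedComponentIn.subset_or_subset (isOpen_bComponent hL hqb)
      (isOpen_otherComponent hL hqb) (disjoint_components hL hqb) hsub with h | h
    · exact h
    · exact absurd (h (mem_connectedComponentIn (bComponent_subset hL hqb hz)))
        (Set.disjoint_left.1 (disjoint_components hL hqb) hz)
  · exact (isConnected_bComponent hL hqb).isPreconnected.subset_connectedComponentIn hz
      (bComponent_subset hL hqb)

/-- `connectedComponentIn_eq_otherComponent`: connectedComponentIn eq otherComponent (auxiliary lemma of the one-shot surgery; the statement is the specification). -/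
theorem connectedComponentIn_eq_otherComponent {z : ℂ} (hz : z ∈ otherComponent hL hqb) :
    connectedComponentIn (D.carrier \ L) z = otherComponent hL hqb := by
  apply Subset.antisymm
  · have hsub : connectedComponentIn (D.carrier \ L) z ⊆ bComponent hL hqb ∪ otherComponent hL hqb :=
      union_components hL hqb ▸ connectedComponentIn_subset _ _
    rcases isPreconnected_connectedComponentIn.subset_or_subset (isOpen_bComponent hL hqb)
      (isOpen_otherComponent hL hqb) (disjoint_components hL hqb) hsub with h | h
    · exact absurd (h (mem_connectedComponentIn (otherComponent_subset hL hqb hz)))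
        (Set.disjoint_right.1 (disjoint_components hL hqb) hz)
    · exact h
  · exact (isConnected_otherComponent hL hqb).isPreconnected.subset_connectedComponentIn hz
      (otherComponent_subset hL hqb)

/-- **The typed remaining domain after a crosscut past is the crosscut domain**: for every
explored past `p` whose trace is the crosscut `L`, `remainingDomain D p` is the carrier of
`crosscutDomain` — so the typed Markov kernel of an admissible family RENEWS there
(`MarkovRenewal.kernel_eq_of_jordan_remaining`) with tip `q` and target `b`. [folklore] -/
theorem remainingDomain_eq_crosscutDomain {p : CurveClass ℂ} (hp : p.range = L) :
    remainingDomain D p = (crosscutDomain hL hqb).carrier := by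
  ext z
  simp only [remainingDomain, hp, mem_setOf_eq, carrier_crosscutDomain]
  constructor
  · rintro ⟨hz, hb⟩
    have hz' : z ∈ bComponent hL hqb ∪ otherComponent hL hqb := by rwa [union_components]
    rcases hz' with h | h
    · exact h
    · rw [connectedComponentIn_eq_otherComponent hL hqb h] at hb
      exact absurd hb (pt_one_notMem_closure_otherComponent hL hqb)
  · intro hz
    refine ⟨bComponent_subset hL hqb hz, ?_⟩
    rw [connectedComponentIn_eq_bComponent hL hqb hz]
    exact frontier_subset_closure (pt_one_mem_frontier_bComponent hL hqb)

end Domain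

end Summit.CriticalPhenomena.CardyFormulaZ2.Theorems.CardyRotToConfR2SymmetryUpgrade.Negative
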